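import Mathlib
import Summits.Ventures.PercRepro2.HCov
import Summits.Ventures.PercRepro2.GcSkelRules
import Summits.Ventures.PercRepro2.GcSkelReductionT
import Summits.Ventures.PercRepro2.GcSkelReductionMin
import Summits.Ventures.PercRepro2.GcSkelReductionO
import Summits.Ventures.PercRepro2.GcSkelReductionOB
import Summits.Ventures.PercRepro2.GcSkelReductionMinOB
import Summits.Ventures.PercRepro2.GcSkelReductionH
import Summits.Ventures.PercRepro2.GcSkelReductionMinH
import Summits.Ventures.PercRepro2.GcSkelReductionActive
import Summits.Ventures.PercRepro2.GcSkelReductionBounded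
import Summits.Ventures.PercRepro2.GcSkelReductionZ
import Summits.Ventures.PercRepro2.GcTransport
import Summits.Ventures.PercRepro2.A3RootEdgeAll
import Summits.Ventures.PercRepro2.GcRootPair
import Summits.Ventures.PercRepro2.GcInterior
import Summits.Ventures.PercRepro2.GcRational
import Summits.Ventures.PercRepro2.GcHatConn
import Summits.Ventures.PercRepro2.GcSkelReductionHat
import Summits.Ventures.PercRepro2.GcBundleConn
import Summits.Ventures.PercRepro2.GcBundle

/-!
# The residual with no root bundle (blind cell PercRepro2, typer-1 g57)

A ROOT BUNDLE is a mark-free vertex set `W` whose external terminals are the two roots `a₁, a₂`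
and one further vertex `v` (`Bundle.IsBundle`), touched by three distinct non-loop edges
(`Bundle.HasBundle`) — the hat (`Hat.IsHatAt`, `W = {u}`) for an arbitrary `W`. At interior
weights it is an exact REDUCTION of the weighted calculus (`GcBundle.lean`): `Gc` is `c³` times
`Gc` of the bundle graph — `W` cut off, the two patterns `a₁ – v`, `a₂ – v` on independent edges —
under the bundle weights, with `c > 0`, and the bundle graph has fewer non-loop edges. The weighted
twin of the typed lane's root bundle (`RootBundlePart`).

Folded into the class of record through the size-bounded residual theorem, with the interior
reduction (`HCov_of_int`) at the base; the hat clause is absorbed (`hasBundle_of_hasHat`):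

* **`WReducedMinHAZB`** := `WReducedMinHAZ` ∧ no root bundle (30 clauses; a subclass of
  `WReducedMinHAZH`, `wredMinHAZH_of_wredMinHAZB`), the closures `HCovWRedMinHAZB_int_le` /
  `HCovWRedMinHAZB_int_all` / `HCovWRedMinHAZB_all`;
* **`HCov_of_HCovWRedMinHAZB_int_le`** — the strong induction on `nonLoopCard` over all graphs;
* **`HCov_all_iff_HCovWRedMinHAZB_int_all`**, **`HCov_all_iff_HCovWRedMinHAZB_all`**,
  **`HCov_all_real_iff_HCovWRedMinHAZB_int_all_rat`** — THE STATEMENT OF RECORD: the crux over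
  `ℝ` is (HCOV) on the class of record with no root bundle, at rational interior weights.

Standard axioms.
-/

namespace Summit.Ventures.PercRepro2

open CovForm RECM

namespace WRed

/-! ## The class -/

section ClassB

variable {V : Type*} {E : Type*} [Fintype E] [DecidableEq E] [DecidableEq V]

/-- **The class of record with no root bundle**: `WReducedMinHAZ` and no root bundle. -/
structure WReducedMinHAZB (ends : E → Sym2 V) (o a₁ a₂ a₃ b : V) : Prop
    extends WReducedMinHAZ ends o a₁ a₂ a₃ b where
  /-- no mark-free vertex set has exactly the two roots and one further vertex as terminals -/
  noBundle : ¬ Bundle.HasBundle ends o a₁ a₂ a₃ b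

omit [Fintype E] [DecidableEq E] [DecidableEq V] in
/-- A hat is a root bundle (`W = {u}`, `v = w`, the three edges of the hat). -/
lemma hasBundle_of_hasHat {ends : E → Sym2 V} {o a₁ a₂ a₃ b : V}
    (h : HasHat ends o a₁ a₂ a₃ b) : Bundle.HasBundle ends o a₁ a₂ a₃ b := by
  obtain ⟨u, w, e₁, e₂, e₃, hu, hh⟩ := h
  refine ⟨{u}, w, ⟨?_, ?_, ?_, ?_⟩, ?_, hh.wa1, hh.wa2, e₁, e₂, e₃, hh.e12, hh.e13, hh.e23,
    ?_, ?_, ?_, ?_, ?_, ?_⟩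
  · simpa using hh.ua1.symm
  · simpa using hh.ua2.symm
  · simpa using hh.uw.symm
  · intro e he x y hxy
    have hxy' : x ∈ ends e ∧ y ∈ ends e := by rw [hxy]; simp
    obtain ⟨z, hz, y', hz'⟩ := he
    have hz1 : z = u := hz
    have hu : u ∈ ends e := by rw [hz', ← hz1]; simp
    by_cases h1 : e = e₁
    · subst h1
      rw [hh.h1, Sym2.eq_iff] at hxy
      rcases hxy with ⟨rfl, rfl⟩ | ⟨rfl, rfl⟩ <;> simp
    by_cases h2 : e = e₂
    · subst h2
      rw [hh.h2, Sym2.eq_iff] at hxy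
      rcases hxy with ⟨rfl, rfl⟩ | ⟨rfl, rfl⟩ <;> simp
    by_cases h3 : e = e₃
    · subst h3
      rw [hh.h3, Sym2.eq_iff] at hxy
      rcases hxy with ⟨rfl, rfl⟩ | ⟨rfl, rfl⟩ <;> simp
    -- every other edge at `u` is a loop at `u`
    have hd := hh.other e h1 h2 h3 hu
    rw [hxy, Sym2.mk_isDiag_iff] at hd
    subst hd
    rw [hxy, Sym2.mem_iff] at hu
    rcases hu with rfl | rfl <;> simp
  · intro y hy
    rw [Set.mem_singleton_iff] at hy
    subst hy
    exact hu
  · exact ⟨u, rfl, a₁, by rw [hh.h1, Sym2.eq_swap]⟩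
  · exact ⟨u, rfl, a₂, by rw [hh.h2, Sym2.eq_swap]⟩
  · exact ⟨u, rfl, w, by rw [hh.h3, Sym2.eq_swap]⟩
  · rw [hh.h1, Sym2.mk_isDiag_iff]; exact hh.ua1.symm
  · rw [hh.h2, Sym2.mk_isDiag_iff]; exact hh.ua2.symm
  · rw [hh.h3, Sym2.mk_isDiag_iff]; exact hh.uw.symm

omit [DecidableEq E] in
/-- The class of record with no root bundle is contained in the class of record with no hat. -/
lemma wredMinHAZH_of_wredMinHAZB {ends : E → Sym2 V} {o a₁ a₂ a₃ b : V}
    (h : WReducedMinHAZB ends o a₁ a₂ a₃ b) : WReducedMinHAZH ends o a₁ a₂ a₃ b :=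
  ⟨h.toWReducedMinHAZ, fun hh => h.noBundle (hasBundle_of_hasHat hh)⟩

end ClassB

section ClosureB

variable (R : Type*) [Field R] [LinearOrder R] [IsStrictOrderedRing R]

/-- **(HCOV) on the class of record with no root bundle, at interior weights, at most `N`
non-loop edges.** -/
def HCovWRedMinHAZB_int_le (N : ℕ) : Prop :=
  ∀ (V E : Type) [Fintype V] [DecidableEq V] [Fintype E] [DecidableEq E]
    (ends : E → Sym2 V), nonLoopCard ends ≤ N → ∀ (p : E → R), IsIntVec p →
    ∀ o a₁ a₂ a₃ b : V, a₁ ≠ a₂ → a₁ ≠ a₃ → a₂ ≠ a₃ → o ≠ a₁ → o ≠ a₂ → o ≠ a₃ → o ≠ b →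
      b ≠ a₁ → b ≠ a₂ → b ≠ a₃ → WReducedMinHAZB ends o a₁ a₂ a₃ b → HCov p ends o a₁ a₂ a₃ b

/-- **(HCOV) on the class of record with no root bundle, at interior weights.** -/
def HCovWRedMinHAZB_int_all : Prop :=
  ∀ (V E : Type) [Fintype V] [DecidableEq V] [Fintype E] [DecidableEq E]
    (ends : E → Sym2 V) (p : E → R), IsIntVec p →
    ∀ o a₁ a₂ a₃ b : V, a₁ ≠ a₂ → a₁ ≠ a₃ → a₂ ≠ a₃ → o ≠ a₁ → o ≠ a₂ → o ≠ a₃ → o ≠ b →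
      b ≠ a₁ → b ≠ a₂ → b ≠ a₃ → WReducedMinHAZB ends o a₁ a₂ a₃ b → HCov p ends o a₁ a₂ a₃ b

/-- **(HCOV) on the class of record with no root bundle.** -/
def HCovWRedMinHAZB_all : Prop :=
  ∀ (V E : Type) [Fintype V] [DecidableEq V] [Fintype E] [DecidableEq E]
    (ends : E → Sym2 V) (p : E → R), IsProbVec p →
    ∀ o a₁ a₂ a₃ b : V, a₁ ≠ a₂ → a₁ ≠ a₃ → a₂ ≠ a₃ → o ≠ a₁ → o ≠ a₂ → o ≠ a₃ → o ≠ b →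
      b ≠ a₁ → b ≠ a₂ → b ≠ a₃ → WReducedMinHAZB ends o a₁ a₂ a₃ b → HCov p ends o a₁ a₂ a₃ b

end ClosureB

section MainB

variable {R : Type*} [Field R] [LinearOrder R] [IsStrictOrderedRing R]

/-- **The reduction to the class of record with no root bundle**, size-bounded: strong induction
on `nonLoopCard` over all graphs; at each size the bounded residual theorem is fed the `WReducedT`
instances, decided at interior weights (`HCov_of_int`): an edge among the roots is looped, a root
bundle is collapsed (fewer non-loop edges — the induction hypothesis), the star / hub /
active-vertex class theorems apply, or the instance is in `WReducedMinHAZB`. -/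
theorem HCov_of_HCovWRedMinHAZB_int_le (N : ℕ) (hZ : HCovWRedMinHAZB_int_le R N) (n : ℕ) :
    n ≤ N → ∀ (V E : Type) [Fintype V] [DecidableEq V] [Fintype E] [DecidableEq E]
      (ends : E → Sym2 V), nonLoopCard ends ≤ n → ∀ (p : E → R), IsProbVec p →
      ∀ o a₁ a₂ a₃ b : V, a₁ ≠ a₂ → a₁ ≠ a₃ → a₂ ≠ a₃ → o ≠ a₁ → o ≠ a₂ → o ≠ a₃ → o ≠ b →
        b ≠ a₁ → b ≠ a₂ → b ≠ a₃ → HCov p ends o a₁ a₂ a₃ b := by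
  induction n using Nat.strong_induction_on with
  | _ n ih =>
  intro hnN
  refine HCov_of_HCovWRedT_le n ?_
  intro V E _ _ _ _ ends hle p hp o a₁ a₂ a₃ b h12 h13 h23 ho1 ho2 ho3 hob hb1 hb2 hb3 hT
  -- decide the instance at interior weights
  refine HCov_of_int ends o a₁ a₂ a₃ b (fun q hq => ?_) p hp
  -- an edge among the roots: loop it, one non-loop edge fewer
  by_cases hZe : ∃ e, IsRootsEdge ends a₁ a₂ a₃ e
  · obtain ⟨e, he⟩ := hZe
    rcases he with he | he
    · have hlt : nonLoopCard (Function.update ends e s(a₁, a₁)) < n :=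
        lt_of_lt_of_le (nonLoopCard_update_loop_lt ends
          (by rw [he, Sym2.mk_isDiag_iff]; exact h12) a₁) hle
      exact RootPair.HCov_of_loop_of_rootPair q hq.isProbVec he o a₃ b
        (ih _ hlt (le_trans hlt.le hnN) V E _ le_rfl q hq.isProbVec o a₁ a₂ a₃ b h12 h13 h23 ho1
          ho2 ho3 hob hb1 hb2 hb3)
    · have hlt : nonLoopCard (Function.update ends e s(a₃, a₃)) < n :=
        lt_of_lt_of_le (nonLoopCard_update_loop_lt ends (not_isDiag_of_isRootEdge h13 h23 he) a₃)
          hle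
      exact HCov_of_loop_of_isRootEdge he q hq.isProbVec
        (ih _ hlt (le_trans hlt.le hnN) V E _ le_rfl q hq.isProbVec o a₁ a₂ a₃ b h12 h13 h23 ho1
          ho2 ho3 hob hb1 hb2 hb3)
  -- a root bundle: collapse it, fewer non-loop edges
  by_cases hBd : Bundle.HasBundle ends o a₁ a₂ a₃ b
  · exact Bundle.HCov_of_hasBundle hq h12 (fun ends' hlt p' hp' =>
      ih _ (lt_of_lt_of_le hlt hle) (le_trans (lt_of_lt_of_le hlt hle).le hnN) V E ends' le_rfl
        p' hp' o a₁ a₂ a₃ b h12 h13 h23 ho1 ho2 ho3 hob hb1 hb2 hb3) hBd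
  -- the class theorems on `(ends, marks)`
  have hMin : WReducedMin ends o a₁ a₂ a₃ b := wredT_iff_wredMin.1 hT
  by_cases hO : OToMarks ends o a₁ a₂ b
  · exact HCov_of_oToMarks hMin.simple hO ho1 ho2 ho3 hob h12 hb1 hb2 q hq.isProbVec
  by_cases hBs : OToMarks ends b a₁ a₂ o
  · exact HCov_of_bToMarks hMin.simple hBs hb1 hb2 hb3 hob h12 ho1 ho2 q hq.isProbVec
  by_cases hOA : OTwoToMarks ends o a₃ b
  · exact HCov_of_oA3BToMarks hMin.simple hOA ho1 ho2 ho3 hob h13 hb1 hb3 q hq.isProbVec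
  by_cases hPH : PoleHubToMarks ends o a₁ a₂ a₃ b
  · exact HCov_of_poleHubToMarks hMin.simple hPH ho1 ho2 ho3 hob h12 h13 hb1.symm h23 hb2.symm
      hb3.symm q hq.isProbVec
  by_cases hA : OneActiveUnmarked ends o a₁ a₂ a₃ b
  · exact HCov_of_oneActiveUnmarked hA q hq.isProbVec
  -- the class of record with no root bundle
  push Not at hZe
  exact hZ V E ends (le_trans hle hnN) q hq o a₁ a₂ a₃ b h12 h13 h23 ho1 ho2 ho3 hob hb1 hb2 hb3
    ⟨⟨⟨⟨⟨hMin, hO, hBs, hOA⟩, hPH⟩, hA⟩, hZe⟩, hBd⟩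

omit [IsStrictOrderedRing R] in
/-- The closure gives every bound. -/
theorem HCovWRedMinHAZB_int_le_of_all (h : HCovWRedMinHAZB_int_all R) (N : ℕ) :
    HCovWRedMinHAZB_int_le R N :=
  fun V E _ _ _ _ ends _ p hp o a₁ a₂ a₃ b h12 h13 h23 ho1 ho2 ho3 hob hb1 hb2 hb3 hred =>
    h V E ends p hp o a₁ a₂ a₃ b h12 h13 h23 ho1 ho2 ho3 hob hb1 hb2 hb3 hred

/-- **THE CLASS OF RECORD WITH NO ROOT BUNDLE**: (HCOV) for every finite weighted graph with five
distinct marks follows from (HCOV) on `WReducedMinHAZB` at interior weights. -/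
theorem HCov_all_of_HCovWRedMinHAZB_int_all (hZ : HCovWRedMinHAZB_int_all R) : HCov_all R := by
  intro V E _ _ _ _ ends p hp o a₁ a₂ a₃ b h12 h13 h23 ho1 ho2 ho3 hob hb1 hb2 hb3
  exact HCov_of_HCovWRedMinHAZB_int_le _ (HCovWRedMinHAZB_int_le_of_all hZ _) _ le_rfl V E ends
    le_rfl p hp o a₁ a₂ a₃ b h12 h13 h23 ho1 ho2 ho3 hob hb1 hb2 hb3

omit [IsStrictOrderedRing R] in
/-- The crux gives the closure. -/
theorem HCovWRedMinHAZB_int_all_of_HCov_all (h : HCov_all R) : HCovWRedMinHAZB_int_all R :=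
  fun V E _ _ _ _ ends p hp o a₁ a₂ a₃ b h12 h13 h23 ho1 ho2 ho3 hob hb1 hb2 hb3 _ =>
    h V E ends p hp.isProbVec o a₁ a₂ a₃ b h12 h13 h23 ho1 ho2 ho3 hob hb1 hb2 hb3

/-- **THE CRUX ON THE CLASS OF RECORD WITH NO ROOT BUNDLE, AT INTERIOR WEIGHTS**:
`HCov_all ↔ HCovWRedMinHAZB_int_all`. -/
theorem HCov_all_iff_HCovWRedMinHAZB_int_all : HCov_all R ↔ HCovWRedMinHAZB_int_all R :=
  ⟨HCovWRedMinHAZB_int_all_of_HCov_all, HCov_all_of_HCovWRedMinHAZB_int_all⟩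

omit [IsStrictOrderedRing R] in
/-- The closure at every weight gives the interior closure. -/
theorem HCovWRedMinHAZB_int_all_of_all (h : HCovWRedMinHAZB_all R) : HCovWRedMinHAZB_int_all R :=
  fun V E _ _ _ _ ends p hp o a₁ a₂ a₃ b h12 h13 h23 ho1 ho2 ho3 hob hb1 hb2 hb3 hred =>
    h V E ends p hp.isProbVec o a₁ a₂ a₃ b h12 h13 h23 ho1 ho2 ho3 hob hb1 hb2 hb3 hred

/-- **THE CRUX ON THE CLASS OF RECORD WITH NO ROOT BUNDLE**: `HCov_all ↔ HCovWRedMinHAZB_all`. -/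
theorem HCov_all_iff_HCovWRedMinHAZB_all : HCov_all R ↔ HCovWRedMinHAZB_all R :=
  ⟨fun h V E _ _ _ _ ends p hp o a₁ a₂ a₃ b h12 h13 h23 ho1 ho2 ho3 hob hb1 hb2 hb3 _ =>
      h V E ends p hp o a₁ a₂ a₃ b h12 h13 h23 ho1 ho2 ho3 hob hb1 hb2 hb3,
    fun h => HCov_all_of_HCovWRedMinHAZB_int_all (HCovWRedMinHAZB_int_all_of_all h)⟩

omit [IsStrictOrderedRing R] in
/-- The closure on the class with no hat gives the closure on the subclass with no root
bundle. -/
theorem HCovWRedMinHAZB_int_all_of_HCovWRedMinHAZH_int_all (h : HCovWRedMinHAZH_int_all R) :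
    HCovWRedMinHAZB_int_all R :=
  fun V E _ _ _ _ ends p hp o a₁ a₂ a₃ b h12 h13 h23 ho1 ho2 ho3 hob hb1 hb2 hb3 hred =>
    h V E ends p hp o a₁ a₂ a₃ b h12 h13 h23 ho1 ho2 ho3 hob hb1 hb2 hb3
      (wredMinHAZH_of_wredMinHAZB hred)

end MainB

section Real

/-- **THE STATEMENT OF RECORD**: the crux over `ℝ` is (HCOV) on the class of record with no root
bundle, at rational weights in `(0, 1)^E`. -/
theorem HCov_all_real_iff_HCovWRedMinHAZB_int_all_rat :
    HCov_all ℝ ↔ HCovWRedMinHAZB_int_all ℚ :=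
  HCov_all_real_iff_rat.trans (HCov_all_iff_HCovWRedMinHAZB_int_all (R := ℚ))

end Real

end WRed

end Summit.Ventures.PercRepro2
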